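import Summits.ValiantsHypothesis.ValiantsHypothesis.Theorems.KPlusLogSqLawTridiagonalRealStaticUnitSplitting
import Summits.ValiantsHypothesis.ValiantsHypothesis.Theorems.KPlusLogSqLawTridiagonalRealStaticUnitExtremeClassType

/-!
# Route «KPlusLogSqLaw», crux `WeakLifting` (stmt-ValiantsHypothesis-19561) — REAL side of the tridiagonal sector:
# the UNIT-COEFFICIENT sub-sector — the DOMINANT SIDE: pivot rules at a zero with dominant edges (all sizes); sizes `≤ 8`

HONEST FRAMING.  Helper theorems (`--supports stmt-ValiantsHypothesis-19561 --as helper`), seat val-sym-lift-p1 (g19), cell `pub-symmetroid`,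
2026-08-28; companion of `…UnitSplitting` (p641078) and of g18's `…UnitCrossingDirection` / `…UnitExtremeClassType`.  Continuants
`D_k = pathDet (fun _ => 1) d (fun _ => 1) f k`; at a zero `x > 0` of `D_m` (`m = n + 2`) the kernel-vector energies `e_k = D_kD_{k+1}x^{−2F_k}` and
masses `μ_i` satisfy `μ_0 = e_0`, `μ_{i+1} = e_i + e_{i+1}`, `μ_{m−1} = e_{m−2}`, `μ_i > 0`, and an edge `k` is DOMINANT at `x`
(`x^{d_k + d_{k+1}} < x^{2f_k}`; for positive slopes this is `x > 1`) iff `μ_kμ_{k+1} < e_k²`.  Proved here (all exponents):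
* **DOMINANT-CHAIN RULES** (pure bookkeeping, `dominantChain_*`): with all edges dominant, `e_1 < 0`, `e_{m−3} < 0`, a negative energy has positive
  neighbours, and NO POSITIVE ENERGY SITS BETWEEN TWO NON-NEGATIVE ONES;
* on the dominant side of a positive-slope design (`x > 1`): `D_1 > 0`, `D_2 < 0`, `D_3 < 0` (`eval_signs_above_one`), so blocks of sizes `≤ 3` are
  never singular above `1`, and (`nondegenerate_above_one_of_le_eight`) EVERY zero above `1` of a design of size `m ≤ 8` is non-degenerate;
* **SIZES 3 AND 5 HAVE NO ZERO ABOVE THE RESONANCE** (`eval_ne_zero_above_one_three/five`); **SIZES 4, 6, 8: EVERY ZERO ABOVE THE RESONANCE IS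
  TOP CLASS** (`alternating_above_one_of_even`: alternating pivot products `(−1)^k D_kD_{k+1} > 0`) — hence of NEGATIVE TYPE
  (`negType_above_one_of_even`, via g18 `negType_of_alternating_above_one`) with `D′_m·D_{m−1} < 0` (`deriv_mul_prev_neg_above_one_of_even`): every
  zero above `1` is simple and adds a negative eigenvalue.  Size `7` is the first with an `A`-vertex above `1` (forced energy word `+ − + + − +`), where
  the direction can reverse (memo CROSSING-DIRECTION-liftp1g18.md §3: located real-slope design, inertia `3 → 2` at `x = e`).
Nothing here is an upper law for the register (α NO MOVER); nothing bears on `WeakLifting` / `TropicalB` (stmt-19771) in their windows, Conjecture B,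
the Door-A registers, `MatrixDescartes` (stmt-18050) or VP ≠ VNP.
[this seat; folklore: continuants, LDLᵀ pivots, kernel vectors of Jacobi matrices]
-/

-- `Summit.ValiantsHypothesis.ValiantsHypothesis.…` repeats a component by the D-0017 layout (single-conjunct summit); the name is mandated.
set_option linter.dupNamespace false
set_option autoImplicit false

namespace Summit.ValiantsHypothesis.ValiantsHypothesis.Theorems.KPlusLogSqLaw
namespace StaticTridiagonalRealUnit

open Real Finset Polynomial Matrix
open Summit.ValiantsHypothesis.ValiantsHypothesis.Theorems.KPlusLogSqLaw.StaticTridiagonalRealPotential (pathDet)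

variable (d : ℕ → ℕ) (f : ℕ → ℕ)

/-! ### 1. Dominant chains: bookkeeping rules for energies and masses -/

/-- first rule: `μ_0 = e_0 > 0` and edge `0` dominant ⇒ `e_1 < 0`. [this file] -/
theorem dominantChain_e_one_neg (e μ : ℕ → ℝ) (hμ0 : μ 0 = e 0) (hμ1 : μ 1 = e 0 + e 1) (hpos : 0 < μ 0)
    (hdom : μ 0 * μ 1 < e 0 ^ 2) : e 1 < 0 := by
  rw [hμ0, hμ1] at hdom; rw [hμ0] at hpos; nlinarith

/-- last rule: `μ_{n+1} = e_n > 0` and edge `n` dominant ⇒ `e_{n−1} < 0` (stated with `n = k + 1`). [this file] -/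
theorem dominantChain_e_prev_neg (e μ : ℕ → ℝ) (k : ℕ) (hμk : μ (k + 1) = e k + e (k + 1)) (hend : μ (k + 2) = e (k + 1))
    (hpos : 0 < μ (k + 2)) (hdom : μ (k + 1) * μ (k + 2) < e (k + 1) ^ 2) : e k < 0 := by
  rw [hμk, hend] at hdom; rw [hend] at hpos; nlinarith

/-- interior rule: edge `k+1` dominant ⇒ NOT (`e_k ≥ 0`, `e_{k+1} > 0`, `e_{k+2} ≥ 0`). [this file] -/
theorem dominantChain_no_flanked_pos (e μ : ℕ → ℝ) (k : ℕ) (hμk : μ (k + 1) = e k + e (k + 1)) (hμk1 : μ (k + 2) = e (k + 1) + e (k + 2))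
    (hdom : μ (k + 1) * μ (k + 2) < e (k + 1) ^ 2) (h0 : 0 ≤ e k) (h1 : 0 < e (k + 1)) (h2 : 0 ≤ e (k + 2)) : False := by
  rw [hμk, hμk1] at hdom; nlinarith [mul_nonneg h0 h2, mul_nonneg h0 h1.le, mul_nonneg h1.le h2]

/-- mass rule: `μ_{k+1} = e_k + e_{k+1} > 0` ⇒ a negative energy has positive neighbours. [this file] -/
theorem chain_pos_of_neg (e μ : ℕ → ℝ) (k : ℕ) (hμk : μ (k + 1) = e k + e (k + 1)) (hpos : 0 < μ (k + 1)) :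
    (e k < 0 → 0 < e (k + 1)) ∧ (e (k + 1) < 0 → 0 < e k) := by
  rw [hμk] at hpos; exact ⟨fun h => by linarith, fun h => by linarith⟩

/-! ### 2. The dictionary at a non-degenerate zero with dominant edges -/

/-- **DOMINANT DICTIONARY**: at a zero `x > 0` of `D_{n+2}` with `D_1, …, D_{n+1} ≠ 0` and every edge dominant (`x^{d_k+d_{k+1}} < x^{2f_k}`), the
pivot products `P_k = D_kD_{k+1}` obey: `P_0 > 0`, `P_n > 0`, `P_1 < 0` and `P_{n−1} < 0` (for `n ≥ 1`), a negative `P_k` has positive neighbours,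
and no positive `P_{k+1}` (`k + 2 ≤ n`) is flanked by non-negative `P_k`, `P_{k+2}`. [this file] -/
theorem pivot_rules_of_dominant (n : ℕ) (x : ℝ) (hx : 0 < x)
    (hdom : ∀ k, k ≤ n → x ^ (d k + d (k + 1)) < x ^ (2 * f k))
    (hroot : (pathDet (fun _ => (1 : ℝ)) d (fun _ => (1 : ℝ)) f (n + 2)).eval x = 0)
    (hnd : ∀ k, 0 < k → k < n + 2 → (pathDet (fun _ => (1 : ℝ)) d (fun _ => (1 : ℝ)) f k).eval x ≠ 0) :
    (0 < (pathDet (fun _ => (1 : ℝ)) d (fun _ => (1 : ℝ)) f 0).eval x * (pathDet (fun _ => (1 : ℝ)) d (fun _ => (1 : ℝ)) f 1).eval x) ∧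
    (0 < (pathDet (fun _ => (1 : ℝ)) d (fun _ => (1 : ℝ)) f n).eval x * (pathDet (fun _ => (1 : ℝ)) d (fun _ => (1 : ℝ)) f (n + 1)).eval x) ∧
    (1 ≤ n → (pathDet (fun _ => (1 : ℝ)) d (fun _ => (1 : ℝ)) f 1).eval x * (pathDet (fun _ => (1 : ℝ)) d (fun _ => (1 : ℝ)) f 2).eval x < 0) ∧
    (1 ≤ n → (pathDet (fun _ => (1 : ℝ)) d (fun _ => (1 : ℝ)) f (n - 1)).eval x * (pathDet (fun _ => (1 : ℝ)) d (fun _ => (1 : ℝ)) f n).eval x < 0) ∧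
    (∀ k, k + 1 ≤ n →
      ((pathDet (fun _ => (1 : ℝ)) d (fun _ => (1 : ℝ)) f k).eval x * (pathDet (fun _ => (1 : ℝ)) d (fun _ => (1 : ℝ)) f (k + 1)).eval x < 0 →
        0 < (pathDet (fun _ => (1 : ℝ)) d (fun _ => (1 : ℝ)) f (k + 1)).eval x * (pathDet (fun _ => (1 : ℝ)) d (fun _ => (1 : ℝ)) f (k + 2)).eval x) ∧
      ((pathDet (fun _ => (1 : ℝ)) d (fun _ => (1 : ℝ)) f (k + 1)).eval x * (pathDet (fun _ => (1 : ℝ)) d (fun _ => (1 : ℝ)) f (k + 2)).eval x < 0 →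
        0 < (pathDet (fun _ => (1 : ℝ)) d (fun _ => (1 : ℝ)) f k).eval x * (pathDet (fun _ => (1 : ℝ)) d (fun _ => (1 : ℝ)) f (k + 1)).eval x)) ∧
    (∀ k, k + 2 ≤ n →
      0 ≤ (pathDet (fun _ => (1 : ℝ)) d (fun _ => (1 : ℝ)) f k).eval x * (pathDet (fun _ => (1 : ℝ)) d (fun _ => (1 : ℝ)) f (k + 1)).eval x →
      0 < (pathDet (fun _ => (1 : ℝ)) d (fun _ => (1 : ℝ)) f (k + 1)).eval x * (pathDet (fun _ => (1 : ℝ)) d (fun _ => (1 : ℝ)) f (k + 2)).eval x →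
      0 ≤ (pathDet (fun _ => (1 : ℝ)) d (fun _ => (1 : ℝ)) f (k + 2)).eval x * (pathDet (fun _ => (1 : ℝ)) d (fun _ => (1 : ℝ)) f (k + 3)).eval x →
      False) := by
  -- energies `e` and masses `μ`
  obtain ⟨e, he⟩ : ∃ e : ℕ → ℝ, ∀ k, e k = (pathDet (fun _ => (1 : ℝ)) d (fun _ => (1 : ℝ)) f k).eval x *
      (pathDet (fun _ => (1 : ℝ)) d (fun _ => (1 : ℝ)) f (k + 1)).eval x / x ^ (2 * ∑ j ∈ range k, f j) := ⟨_, fun _ => rfl⟩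
  obtain ⟨μ, hμ⟩ : ∃ μ : ℕ → ℝ, ∀ i, μ i = x ^ d i * (pathDet (fun _ => (1 : ℝ)) d (fun _ => (1 : ℝ)) f i).eval x ^ 2 /
      x ^ (2 * ∑ j ∈ range i, f j) := ⟨_, fun _ => rfl⟩
  have hD0 : (pathDet (fun _ => (1 : ℝ)) d (fun _ => (1 : ℝ)) f 0).eval x = 1 := (eval_unit_zero_one d f x).1
  have hDne : ∀ k, k ≤ n + 1 → (pathDet (fun _ => (1 : ℝ)) d (fun _ => (1 : ℝ)) f k).eval x ≠ 0 := by
    intro k hk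
    rcases Nat.eq_zero_or_pos k with rfl | hk0
    · rw [hD0]; exact one_ne_zero
    · exact hnd k hk0 (by omega)
  have hμe : ∀ i, μ (i + 1) = e i + e (i + 1) := by
    intro i; rw [hμ, he, he]; exact (energy_succ_add d f x hx i).symm
  have hμ0 : μ 0 = e 0 := by rw [hμ, he]; exact energy_zero d f x
  have heN : e (n + 1) = 0 := by rw [he, show n + 1 + 1 = n + 2 by omega, hroot, mul_zero, zero_div]
  have hμn : μ (n + 1) = e n := by rw [hμe, heN, add_zero]
  have hμpos : ∀ i, i ≤ n + 1 → 0 < μ i := by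
    intro i hi; have := hDne i hi; rw [hμ]; positivity
  -- dominant edges: `μ_j μ_{j+1} < e_j²`
  have hW : ∀ j, j ≤ n → μ j * μ (j + 1) < e j ^ 2 := by
    intro j hj
    have hq := ratio_eq d f x hx j (hDne j (by omega)) (hDne (j + 1) (by omega))
    have he2 : 0 < e j ^ 2 := by
      have : e j ≠ 0 := by
        rw [he]; exact div_ne_zero (mul_ne_zero (hDne j (by omega)) (hDne (j + 1) (by omega))) (pow_ne_zero _ hx.ne')
      positivity
    rw [← div_lt_one he2, he, hμ, hμ, hq, div_lt_one (pow_pos hx _)]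
    exact hdom j hj
  -- sign transfer `e_k ↔ P_k`
  have hsign : ∀ k, (0 < e k ↔ 0 < (pathDet (fun _ => (1 : ℝ)) d (fun _ => (1 : ℝ)) f k).eval x *
      (pathDet (fun _ => (1 : ℝ)) d (fun _ => (1 : ℝ)) f (k + 1)).eval x) ∧
      (e k < 0 ↔ (pathDet (fun _ => (1 : ℝ)) d (fun _ => (1 : ℝ)) f k).eval x *
      (pathDet (fun _ => (1 : ℝ)) d (fun _ => (1 : ℝ)) f (k + 1)).eval x < 0) := by
    intro k
    have hxk : 0 < x ^ (2 * ∑ j ∈ range k, f j) := pow_pos hx _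
    rw [he]
    refine ⟨⟨fun h => by rwa [div_pos_iff_of_pos_right hxk] at h, fun h => div_pos h hxk⟩, ⟨fun h => ?_, fun h => div_neg_of_neg_of_pos h hxk⟩⟩
    by_contra hge
    exact absurd h (not_lt.2 (div_nonneg (not_lt.1 hge) hxk.le))
  have he0 : 0 < e 0 := by rw [← hμ0]; exact hμpos 0 (by omega)
  have hen : 0 < e n := by rw [← hμn]; exact hμpos (n + 1) le_rfl
  refine ⟨(hsign 0).1.1 he0, (hsign n).1.1 hen, fun hn => ?_, fun hn => ?_, fun k hk => ?_, fun k hk h0 h1 h2 => ?_⟩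
  · exact (hsign 1).2.1 (dominantChain_e_one_neg e μ hμ0 (by rw [← hμe 0]) (hμpos 0 (by omega)) (hW 0 (by omega)))
  · obtain ⟨k, rfl⟩ : ∃ k, n = k + 1 := ⟨n - 1, by omega⟩
    rw [Nat.add_sub_cancel]
    exact (hsign k).2.1 (dominantChain_e_prev_neg e μ k (hμe k) (by rw [show k + 2 = k + 1 + 1 by omega]; exact hμn)
      (hμpos (k + 2) le_rfl) (by rw [show k + 2 = k + 1 + 1 by omega]; exact hW (k + 1) le_rfl))
  · have hc := chain_pos_of_neg e μ k (hμe k) (hμpos (k + 1) (by omega))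
    rw [show k + 2 = k + 1 + 1 by omega]
    exact ⟨fun h => (hsign (k + 1)).1.1 (hc.1 ((hsign k).2.2 h)), fun h => (hsign k).1.1 (hc.2 ((hsign (k + 1)).2.2 h))⟩
  · refine dominantChain_no_flanked_pos e μ k (hμe k) (by rw [show k + 2 = k + 1 + 1 by omega]; exact hμe (k + 1))
      (by rw [show k + 2 = k + 1 + 1 by omega]; exact hW (k + 1) (by omega)) ?_ ((hsign (k + 1)).1.2 (by
        rw [show k + 1 + 1 = k + 2 by omega]; exact h1)) ?_
    · rcases lt_or_ge (e k) 0 with h | h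
      · exact absurd h0 (not_le.2 ((hsign k).2.1 h))
      · exact h
    · rcases lt_or_ge (e (k + 2)) 0 with h | h
      · have := (hsign (k + 2)).2.1 h
        rw [show k + 2 + 1 = k + 3 by omega] at this
        exact absurd h2 (not_le.2 this)
      · exact h

/-! ### 3. Above the resonance of a positive-slope design -/

/-- **first continuants above `1`**: all slopes positive, `x > 1` ⇒ `D_1 > 0`, `D_2 < 0` and `D_3 < 0` — blocks of sizes `1, 2, 3` are never singular
above the resonance. [this file] -/
theorem eval_signs_above_one (x : ℝ) (hx1 : 1 < x) (h0 : d 0 + d 1 < 2 * f 0) :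
    0 < (pathDet (fun _ => (1 : ℝ)) d (fun _ => (1 : ℝ)) f 1).eval x ∧
      (pathDet (fun _ => (1 : ℝ)) d (fun _ => (1 : ℝ)) f 2).eval x < 0 ∧
      (pathDet (fun _ => (1 : ℝ)) d (fun _ => (1 : ℝ)) f 3).eval x < 0 := by
  have hx : 0 < x := one_pos.trans hx1
  obtain ⟨e0, e1⟩ := eval_unit_zero_one d f x
  have e2 := eval_unit_add_two d f x 0
  have e3 := eval_unit_add_two d f x 1
  simp only [zero_add] at e2
  have hD1 : 0 < (pathDet (fun _ => (1 : ℝ)) d (fun _ => (1 : ℝ)) f 1).eval x := by rw [e1]; exact pow_pos hx _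
  have hD2 : (pathDet (fun _ => (1 : ℝ)) d (fun _ => (1 : ℝ)) f 2).eval x < 0 := by
    rw [e2, e1, e0, mul_one, ← pow_add, add_comm]
    have := pow_lt_pow_right₀ hx1 h0
    linarith
  refine ⟨hD1, hD2, ?_⟩
  rw [show (3 : ℕ) = 1 + 2 by norm_num, e3]
  nlinarith [pow_pos hx (d (1 + 1)), pow_pos hx (2 * f 1)]

/-- **NON-DEGENERACY ABOVE THE RESONANCE (`m ≤ 8`)**: all slopes positive, `x > 1`, `D_m(x) = 0`, `m ≤ 8` ⇒ `D_k(x) ≠ 0` for `0 < k < m`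
(a vanishing `D_i` splits off two singular blocks, one of size `≤ 3` — impossible above `1`). [this file] -/
theorem nondegenerate_above_one_of_le_eight (m : ℕ) (hm8 : m ≤ 8) (x : ℝ) (hx1 : 1 < x)
    (hslope : ∀ k, k + 1 < m → d k + d (k + 1) < 2 * f k)
    (hroot : (pathDet (fun _ => (1 : ℝ)) d (fun _ => (1 : ℝ)) f m).eval x = 0) :
    ∀ k, 0 < k → k < m → (pathDet (fun _ => (1 : ℝ)) d (fun _ => (1 : ℝ)) f k).eval x ≠ 0 := by
  have hx : 0 < x := one_pos.trans hx1
  intro i hi0 him hDi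
  obtain ⟨hD1, hD2, hD3⟩ := eval_signs_above_one d f x hx1 (hslope 0 (by omega))
  have hi1 : i ≠ 1 := by rintro rfl; exact hD1.ne' hDi
  have hi2 : i ≠ 2 := by rintro rfl; exact hD2.ne hDi
  have hi3 : i ≠ 3 := by rintro rfl; exact hD3.ne hDi
  obtain ⟨n₁, rfl⟩ : ∃ n₁, i = n₁ + 2 := ⟨i - 2, by omega⟩
  set d' : ℕ → ℕ := fun k => d (k + (n₁ + 3)) with hd'_def
  set f' : ℕ → ℕ := fun k => f (k + (n₁ + 3)) with hf'_def
  have hshift := eval_shift_of_eval_eq_zero d f x (n₁ + 1) d' f' (fun _ => rfl) (fun _ => rfl)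
    (by rw [show n₁ + 1 + 1 = n₁ + 2 by omega]; exact hDi)
  have hc : x ^ (2 * f (n₁ + 1)) * (pathDet (fun _ => (1 : ℝ)) d (fun _ => (1 : ℝ)) f (n₁ + 1)).eval x ≠ 0 :=
    mul_ne_zero (pow_ne_zero _ hx.ne') (eval_succ_ne_zero_of_eval_eq_zero d f x hx (n₁ + 1) hDi)
  have hroot' : (pathDet (fun _ => (1 : ℝ)) d' (fun _ => (1 : ℝ)) f' (m - (n₁ + 3))).eval x = 0 := by
    have h := hshift (m - (n₁ + 3))
    rw [show n₁ + 1 + 2 + (m - (n₁ + 3)) = m by omega, hroot] at h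
    rcases mul_eq_zero.1 h.symm with h1 | h1
    · exact absurd (neg_eq_zero.1 h1) hc
    · exact h1
  -- the trailing block has size `≤ 3`: its continuants do not vanish above `1`
  have hs : m - (n₁ + 3) ≤ 3 := by omega
  rcases (show m - (n₁ + 3) = 0 ∨ m - (n₁ + 3) = 1 ∨ m - (n₁ + 3) = 2 ∨ m - (n₁ + 3) = 3 by omega) with h | h | h | h
  · rw [h, (eval_unit_zero_one d' f' x).1] at hroot'; exact one_ne_zero hroot'
  · rw [h, (eval_unit_zero_one d' f' x).2] at hroot'; exact (pow_pos hx _).ne' hroot'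
  · obtain ⟨-, h2, -⟩ := eval_signs_above_one d' f' x hx1 (by
      simp only [hd'_def, hf'_def]; rw [show 1 + (n₁ + 3) = 0 + (n₁ + 3) + 1 by omega]; exact hslope _ (by omega))
    rw [h] at hroot'; exact h2.ne hroot'
  · obtain ⟨-, -, h3⟩ := eval_signs_above_one d' f' x hx1 (by
      simp only [hd'_def, hf'_def]; rw [show 1 + (n₁ + 3) = 0 + (n₁ + 3) + 1 by omega]; exact hslope _ (by omega))
    rw [h] at hroot'; exact h3.ne hroot'

/-- **SIZES 3 AND 5 HAVE NO ZERO ABOVE THE RESONANCE** (all slopes positive). [this file] -/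
theorem eval_ne_zero_above_one_three_five (m : ℕ) (hm : m = 3 ∨ m = 5) (x : ℝ) (hx1 : 1 < x)
    (hslope : ∀ k, k + 1 < m → d k + d (k + 1) < 2 * f k) :
    (pathDet (fun _ => (1 : ℝ)) d (fun _ => (1 : ℝ)) f m).eval x ≠ 0 := by
  intro hroot
  have hx : 0 < x := one_pos.trans hx1
  have hnd := nondegenerate_above_one_of_le_eight d f m (by omega) x hx1 hslope hroot
  rcases hm with rfl | rfl
  · obtain ⟨-, hPn, hP1, -⟩ := pivot_rules_of_dominant d f 1 x hx (fun k hk => pow_lt_pow_right₀ hx1 (hslope k (by omega))) hroot hnd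
    linarith [hP1 le_rfl]
  · obtain ⟨-, -, hP1, hP2, hnb, -⟩ := pivot_rules_of_dominant d f 3 x hx (fun k hk => pow_lt_pow_right₀ hx1 (hslope k (by omega))) hroot hnd
    have h12 := (hnb 1 (by omega)).1 (hP1 (by omega))
    linarith [hP2 (by omega)]

/-- **SIZES 4, 6, 8: EVERY ZERO ABOVE THE RESONANCE IS TOP CLASS** (all slopes positive): at a zero `x > 1` of `D_{n+2}`, `n ∈ {2, 4, 6}`, the pivot
products alternate, `(−1)^k D_kD_{k+1}(x) > 0` for `k ≤ n`. [this file] -/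
theorem alternating_above_one_of_even (n : ℕ) (hn : n = 2 ∨ n = 4 ∨ n = 6) (x : ℝ) (hx1 : 1 < x)
    (hslope : ∀ k, k + 1 < n + 2 → d k + d (k + 1) < 2 * f k)
    (hroot : (pathDet (fun _ => (1 : ℝ)) d (fun _ => (1 : ℝ)) f (n + 2)).eval x = 0) :
    ∀ k, k ≤ n → 0 < (-1) ^ k *
      ((pathDet (fun _ => (1 : ℝ)) d (fun _ => (1 : ℝ)) f k).eval x * (pathDet (fun _ => (1 : ℝ)) d (fun _ => (1 : ℝ)) f (k + 1)).eval x) := by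
  have hx : 0 < x := one_pos.trans hx1
  have hnd := nondegenerate_above_one_of_le_eight d f (n + 2) (by omega) x hx1 hslope hroot
  obtain ⟨hP0, hPn, hP1, hPn1, hnb, hfl⟩ :=
    pivot_rules_of_dominant d f n x hx (fun k hk => pow_lt_pow_right₀ hx1 (hslope k (by omega))) hroot hnd
  have hP1' := hP1 (by omega)
  have hPn1' := hPn1 (by omega)
  -- even positions are positive, odd positions negative
  have hP2 : 0 < (pathDet (fun _ => (1 : ℝ)) d (fun _ => (1 : ℝ)) f 2).eval x * (pathDet (fun _ => (1 : ℝ)) d (fun _ => (1 : ℝ)) f 3).eval x :=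
    (hnb 1 (by omega)).1 hP1'
  intro k hk
  rcases hn with rfl | rfl | rfl
  · interval_cases k
    · simpa using hP0
    · simpa using hP1'
    · simpa using hPn
  · have hP3 : (pathDet (fun _ => (1 : ℝ)) d (fun _ => (1 : ℝ)) f 3).eval x * (pathDet (fun _ => (1 : ℝ)) d (fun _ => (1 : ℝ)) f 4).eval x < 0 := by
      simpa using hPn1'
    interval_cases k
    · simpa using hP0
    · simpa using hP1'
    · simpa using hP2
    · have : (-1 : ℝ) ^ 3 = -1 := by norm_num
      rw [this]; linarith
    · have : (-1 : ℝ) ^ 4 = 1 := by norm_num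
      rw [this]; linarith
  · have hP5 : (pathDet (fun _ => (1 : ℝ)) d (fun _ => (1 : ℝ)) f 5).eval x * (pathDet (fun _ => (1 : ℝ)) d (fun _ => (1 : ℝ)) f 6).eval x < 0 := by
      simpa using hPn1'
    have hP4 : 0 < (pathDet (fun _ => (1 : ℝ)) d (fun _ => (1 : ℝ)) f 4).eval x * (pathDet (fun _ => (1 : ℝ)) d (fun _ => (1 : ℝ)) f 5).eval x :=
      (hnb 4 (by omega)).2 hP5
    -- `P_3 < 0`: a positive `P_3` would be flanked by the positive `P_2`, `P_4`; `P_3 = 0` is excluded by non-degeneracy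
    have hP3 : (pathDet (fun _ => (1 : ℝ)) d (fun _ => (1 : ℝ)) f 3).eval x * (pathDet (fun _ => (1 : ℝ)) d (fun _ => (1 : ℝ)) f 4).eval x < 0 := by
      rcases lt_trichotomy ((pathDet (fun _ => (1 : ℝ)) d (fun _ => (1 : ℝ)) f 3).eval x *
          (pathDet (fun _ => (1 : ℝ)) d (fun _ => (1 : ℝ)) f 4).eval x) 0 with h | h | h
      · exact h
      · exact (mul_ne_zero (hnd 3 (by omega) (by omega)) (hnd 4 (by omega) (by omega)) h).elim
      · exact (hfl 2 (by omega) hP2.le h hP4.le).elim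
    interval_cases k
    · simpa using hP0
    · simpa using hP1'
    · simpa using hP2
    · have : (-1 : ℝ) ^ 3 = -1 := by norm_num
      rw [this]; linarith
    · have : (-1 : ℝ) ^ 4 = 1 := by norm_num
      rw [this]; linarith
    · have : (-1 : ℝ) ^ 5 = -1 := by norm_num
      rw [this]; linarith
    · have : (-1 : ℝ) ^ 6 = 1 := by norm_num
      rw [this]; linarith

/-- **NEGATIVE TYPE ABOVE THE RESONANCE (sizes 4, 6, 8)**: all slopes positive, at every zero `t > 1` of `D_{n+2}` (`n ∈ {2,4,6}`) every non-zero kernel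
vector `u` of the evaluated pencil has `P_u′(t) < 0` — the zero adds a negative eigenvalue. [this file] -/
theorem negType_above_one_of_even (n : ℕ) (hn : n = 2 ∨ n = 4 ∨ n = 6) (t : ℝ) (ht1 : 1 < t)
    (hslope : ∀ k, k + 1 < n + 2 → d k + d (k + 1) < 2 * f k)
    (hroot : (pathDet (fun _ => (1 : ℝ)) d (fun _ => (1 : ℝ)) f (n + 2)).eval t = 0)
    (u : Fin (n + 2) → ℝ) (hu : (∑ κ, t ^ unitExponent d f (n + 2) κ • unitLetter (n + 2) κ) *ᵥ u = 0) (hu0 : u ≠ 0) :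
    (derivative (∑ κ, C (u ⬝ᵥ (unitLetter (n + 2) κ *ᵥ u)) * (X : ℝ[X]) ^ unitExponent d f (n + 2) κ)).eval t < 0 :=
  negType_of_alternating_above_one d f n (by omega) t ht1 hroot
    (nondegenerate_above_one_of_le_eight d f (n + 2) (by omega) t ht1 hslope hroot)
    (alternating_above_one_of_even d f n hn t ht1 hslope hroot) u hu hu0

/-- **DERIVATIVE SIGN ABOVE THE RESONANCE (sizes 4, 6, 8)**: all slopes positive, at every zero `x > 1` of `D_m` (`m ∈ {4,6,8}`):
`D′_m(x)·D_{m−1}(x) < 0`; in particular every zero above `1` is simple. [this file] -/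
theorem deriv_mul_prev_neg_above_one_of_even (n : ℕ) (hn : n = 2 ∨ n = 4 ∨ n = 6) (x : ℝ) (hx1 : 1 < x)
    (hslope : ∀ k, k + 1 < n + 2 → d k + d (k + 1) < 2 * f k)
    (hroot : (pathDet (fun _ => (1 : ℝ)) d (fun _ => (1 : ℝ)) f (n + 2)).eval x = 0) :
    (derivative (pathDet (fun _ => (1 : ℝ)) d (fun _ => (1 : ℝ)) f (n + 2))).eval x *
      (pathDet (fun _ => (1 : ℝ)) d (fun _ => (1 : ℝ)) f (n + 1)).eval x < 0 :=
  deriv_mul_prev_neg_of_slopeEnergy_pos d f n x (one_pos.trans hx1) hroot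
    (slopeEnergy_pos_above_one_of_alternating d f n (by omega) x hx1 hroot
      (nondegenerate_above_one_of_le_eight d f (n + 2) (by omega) x hx1 hslope hroot)
      (alternating_above_one_of_even d f n hn x hx1 hslope hroot))

/-- **SIMPLE ZEROS ABOVE THE RESONANCE (sizes 4, 6, 8)**. [this file] -/
theorem rootMultiplicity_eq_one_above_one_of_even (n : ℕ) (hn : n = 2 ∨ n = 4 ∨ n = 6) (t : ℝ) (ht1 : 1 < t)
    (hslope : ∀ k, k + 1 < n + 2 → d k + d (k + 1) < 2 * f k)
    (hroot : (pathDet (fun _ => (1 : ℝ)) d (fun _ => (1 : ℝ)) f (n + 2)).eval t = 0) :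
    (pathDet (fun _ => (1 : ℝ)) d (fun _ => (1 : ℝ)) f (n + 2)).rootMultiplicity t = 1 := by
  have hder := deriv_mul_prev_neg_above_one_of_even d f n hn t ht1 hslope hroot
  have hP0 : pathDet (fun _ => (1 : ℝ)) d (fun _ => (1 : ℝ)) f (n + 2) ≠ 0 := by
    intro h0
    rw [h0, derivative_zero, eval_zero, zero_mul] at hder
    exact lt_irrefl _ hder
  have hpos : 0 < (pathDet (fun _ => (1 : ℝ)) d (fun _ => (1 : ℝ)) f (n + 2)).rootMultiplicity t :=
    (rootMultiplicity_pos hP0).2 hroot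
  have hle : ¬ 1 < (pathDet (fun _ => (1 : ℝ)) d (fun _ => (1 : ℝ)) f (n + 2)).rootMultiplicity t := by
    rw [one_lt_rootMultiplicity_iff_isRoot hP0]
    rintro ⟨-, h2⟩
    rw [IsRoot.def] at h2
    rw [h2, zero_mul] at hder
    exact lt_irrefl _ hder
  omega

end StaticTridiagonalRealUnit
end Summit.ValiantsHypothesis.ValiantsHypothesis.Theorems.KPlusLogSqLaw
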